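import Summits.KontsevichZagierPeriods.KontsevichZagierPeriods.Theorems.LogKernelConjecture.Negative.Sandwich

/-!
# `LogKernelConjecture` (stmt-KontsevichZagierPeriods-2837) — negative knowledge, part 2: load-bearing hypotheses

Each statement below is the crux VERBATIM with one hypothesis deleted (inlined, no new `Prop`).
* H1 `KZ.relations ≤ R`: deleted, the statement is FALSE (`logKernelConjecture_false_without_relationsLe`;
  witness `R = ker KZ.coeffSum`, `c = [∅]`) — any proof must use H1.
* H2 (closure under the log rule): deleted, the statement is LITERALLY `KZKernelConjecture`
  (`withoutLogClosure_iff_kzKernelConjecture`) — no `_false_without_` theorem short of disproving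
  the period conjecture.
* the guard `KZ.eval c = 0`: deleted (a strengthening), FALSE (`not_logKernelConjectureAllMem`;
  witness `R = ker eval`, `c = [pt, 1]`).
* the side condition `a ≤ b` INSIDE the rule: deleted, the crux becomes TRIVIALLY TRUE
  (`logKernelConjectureWithoutLe_holds`: the empty band over `{b < a}` with free endpoint values puts
  every generator in `R`, so `R = ⊤`) — a vacuity guard, as for `KZ.newtonLeibnizRel`.
* degenerate members `R = ⊤`, `R = ker eval` satisfy hypotheses and conclusion (no junk-model kill).
[cite: KontsevichZagierPeriods2001, §1.2 Conjecture 1]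
-/

noncomputable section

open MeasureTheory Set
open Literature.NumberTheory.Transcendental

namespace Summit.KontsevichZagierPeriods.LiouvilleUnfolding.LogKernelConjectureNegative

open Summit.KontsevichZagierPeriods.KontsevichZagierPeriods.Theses.LiouvilleUnfolding
  (LogKernelConjecture LogPrimitiveNL)

/-! ## §5 Load-bearing hypotheses -/

/-- **H1 is load-bearing**: the crux VERBATIM with hypothesis H1 `KZ.relations ≤ R` deleted is
FALSE.  Witness: `R := ker coeffSum` is closed under the log rule (instances are differences of two
generators) but misses the value-`0` generator `[∅]` (coefficient sum `1`).  Any proof must use H1.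
[folklore] -/
theorem logKernelConjecture_false_without_relationsLe :
    ¬ ∀ (R : AddSubgroup KZ.FormalRep), ClosedUnderLogNL R →
        ∀ c : KZ.FormalRep, KZ.eval c = 0 → c ∈ R := by
  intro h
  have hclosed : ClosedUnderLogNL KZ.coeffSum.ker :=
    (closedUnderLogNL_iff_subset _).2 fun c hc =>
      (AddMonoidHom.mem_ker).2 (coeffSum_eq_zero_of_mem_logNLInstances hc)
  have h0 : KZ.eval (KZ.of (KZ.IntegralRep.empty 0)) = 0 := by
    rw [KZ.eval_of, KZ.IntegralRep.value_empty]
  have h1 := h _ hclosed _ h0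
  rw [AddMonoidHom.mem_ker, KZ.coeffSum_of] at h1
  exact one_ne_zero h1

/-- **H2 deleted = the summit's kernel form, literally**: the crux VERBATIM with hypothesis H2
(closure under the log rule) deleted is equivalent to `KZKernelConjecture` (`R := relations`, resp.
monotonicity).  Hence no `_false_without_logClosure` theorem can be proved short of disproving the
Kontsevich–Zagier conjecture; H2 is what separates the crux from the summit, and by part 1 the gap
is exactly `LogPrimitiveNL`. [folklore] -/
theorem withoutLogClosure_iff_kzKernelConjecture :
    (∀ (R : AddSubgroup KZ.FormalRep), KZ.relations ≤ R →
        ∀ c : KZ.FormalRep, KZ.eval c = 0 → c ∈ R) ↔ KZKernelConjecture :=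
  ⟨fun h c hc => h KZ.relations le_rfl c hc, fun hk _ hR c hc => hR (hk c hc)⟩

/-- The unit representation `[pt, 1]` (KZ-literal: `1/1` over `ℝ⁰`), of value `1`. [folklore] -/
def unitRep : KZ.IntegralRep 0 :=
  KZ.IntegralRep.ofRational Set.univ 1 1 Literature.ModelTheory.ExponentialFields.isSemialgebraic_univ
    (fun _ _ => by simp) (by simp)

/-- `value [pt, 1] = 1`. [folklore] -/
theorem value_unitRep : unitRep.value = 1 := by
  simp only [unitRep, KZ.IntegralRep.value_ofRational]
  simp [MeasureTheory.Measure.real, MeasureTheory.volume_pi]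

/-- **The guard `eval c = 0` is load-bearing**: the crux VERBATIM with the guard deleted from the
conclusion (a strengthening) is FALSE — `R := ker eval` contains the relations (soundness of the
four moves) and is closed under the log rule (part 1, §2), but `[pt, 1] ∉ ker eval`. [folklore] -/
theorem not_logKernelConjectureAllMem :
    ¬ ∀ (R : AddSubgroup KZ.FormalRep), KZ.relations ≤ R → ClosedUnderLogNL R →
        ∀ c : KZ.FormalRep, c ∈ R := by
  intro h
  have h1 := h KZ.eval.ker relations_le_ker closedUnderLogNL_ker (KZ.of unitRep)
  rw [AddMonoidHom.mem_ker, KZ.eval_of, value_unitRep] at h1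
  exact one_ne_zero h1

/-- **Degenerate members of the family satisfy the crux** (no junk-model kill): `R = ⊤`. [folklore] -/
theorem conclusion_holds_at_top :
    KZ.relations ≤ (⊤ : AddSubgroup KZ.FormalRep) ∧ ClosedUnderLogNL ⊤ ∧
      ∀ c : KZ.FormalRep, KZ.eval c = 0 → c ∈ (⊤ : AddSubgroup KZ.FormalRep) :=
  ⟨le_top, (closedUnderLogNL_iff_subset _).2 (Set.subset_univ _), fun _ _ => AddSubgroup.mem_top _⟩

/-- … and `R = ker eval` (the intended extremal model): hypotheses AND conclusion hold. [folklore] -/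
theorem conclusion_holds_at_ker :
    KZ.relations ≤ KZ.eval.ker ∧ ClosedUnderLogNL KZ.eval.ker ∧
      ∀ c : KZ.FormalRep, KZ.eval c = 0 → c ∈ KZ.eval.ker :=
  ⟨relations_le_ker, closedUnderLogNL_ker, fun _ hc => (AddMonoidHom.mem_ker).2 hc⟩

/-! ## §6 Vacuity guard inside the rule: `a ≤ b` -/

/-- The closure hypothesis with the single side condition `∀ x ∈ τ, a x ≤ b x` of the rule DELETED
(all other clauses verbatim). [folklore] -/
def ClosedUnderLogNLWithoutLe (R : AddSubgroup KZ.FormalRep) : Prop :=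
  ∀ (n k : ℕ) (r : KZ.IntegralRep (n + 1)) (r' : KZ.IntegralRep n) (a b : (Fin n → ℝ) → ℝ)
    (h : Fin k → (Fin n → ℝ) → ℝ) (V V' : Fin k → (Fin (n + 1) → ℝ) → ℝ),
    IsSemialgebraicFunOn ℚ r'.domain a → IsSemialgebraicFunOn ℚ r'.domain b →
    r.domain = {z | (Fin.init z : Fin n → ℝ) ∈ r'.domain ∧ a (Fin.init z) ≤ z (Fin.last n) ∧
      z (Fin.last n) ≤ b (Fin.init z)} →
    (∀ i, IsSemialgebraicFunOn ℚ r'.domain (h i)) →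
    (∀ i, IsSemialgebraicFunOn ℚ r.domain (V i)) →
    (∀ i, ∀ z ∈ r.domain, 0 < V i z) →
    (∀ i, ∀ x ∈ r'.domain, ContinuousOn (fun t : ℝ => V i (Fin.snoc x t)) (Set.Icc (a x) (b x))) →
    (∀ i, ∀ x ∈ r'.domain, ∀ t ∈ Set.Ioo (a x) (b x),
      HasDerivAt (fun s : ℝ => V i (Fin.snoc x s)) (V' i (Fin.snoc x t)) t) →
    (∀ i, IntegrableOn (fun z => h i (Fin.init z) * V' i z / V i z) r.domain) →
    (∀ x ∈ r'.domain, ∀ t ∈ Set.Ioo (a x) (b x),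
      r.integrand (Fin.snoc x t) = ∑ i, h i x * V' i (Fin.snoc x t) / V i (Fin.snoc x t)) →
    (∀ x ∈ r'.domain, r'.integrand x =
      ∑ i, h i x * (Real.log (V i (Fin.snoc x (b x))) - Real.log (V i (Fin.snoc x (a x))))) →
    KZ.of r - KZ.of r' ∈ R

/-- **Without `a ≤ b` every generator lies in `R`**: over the base `τ = r'.domain` take `a = 1`,
`b = 0` (empty band, `r := [∅]`), one term `h = r'.integrand`, `V (x, t) = exp (1 − t)` (so
`log V(x, b x) − log V(x, a x) = 1`); every analytic clause is vacuous on the empty band / empty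
fibres, and the instance reads `[∅] − [r'] ∈ R`. [folklore] -/
theorem of_mem_of_closedUnderLogNLWithoutLe {R : AddSubgroup KZ.FormalRep} (hrel : KZ.relations ≤ R)
    (hR : ClosedUnderLogNLWithoutLe R) {n : ℕ} (r' : KZ.IntegralRep n) : KZ.of r' ∈ R := by
  have h1 : IsSemialgebraicFunOn ℚ r'.domain (fun _ => (1 : ℝ)) := by
    simpa using isSemialgebraicFunOn_aeval r'.isSemialgebraic_domain (1 : MvPolynomial (Fin n) ℚ)
  have h0 : IsSemialgebraicFunOn ℚ r'.domain (fun _ => (0 : ℝ)) := by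
    simpa using isSemialgebraicFunOn_aeval r'.isSemialgebraic_domain (0 : MvPolynomial (Fin n) ℚ)
  have hdom : (KZ.IntegralRep.empty (n + 1)).domain =
      {z : Fin (n + 1) → ℝ | (Fin.init z : Fin n → ℝ) ∈ r'.domain ∧ (1 : ℝ) ≤ z (Fin.last n) ∧
        z (Fin.last n) ≤ 0} := by
    ext z
    simp only [KZ.IntegralRep.domain_empty, Set.mem_empty_iff_false, Set.mem_setOf_eq, false_iff]
    rintro ⟨-, h1, h2⟩
    linarith
  have hV : IsSemialgebraicFunOn ℚ (KZ.IntegralRep.empty (n + 1)).domain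
      (fun z : Fin (n + 1) → ℝ => Real.exp (1 - z (Fin.last n))) :=
    (isSemialgebraicFunOn_aeval Literature.ModelTheory.ExponentialFields.isSemialgebraic_empty 0).congr
      fun _ hx => hx.elim
  have hIoo : ∀ t : ℝ, t ∉ Set.Ioo (1 : ℝ) 0 := fun t ht => by linarith [ht.1, ht.2]
  have key := hR n 1 (KZ.IntegralRep.empty (n + 1)) r' (fun _ => 1) (fun _ => 0)
    (fun _ => r'.integrand) (fun _ z => Real.exp (1 - z (Fin.last n))) (fun _ _ => 0) h1 h0 hdom
    (fun _ => r'.isSemialgebraicFunOn_integrand) (fun _ => hV) (fun _ z hz => hz.elim)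
    (fun _ x _ => by simp) (fun _ x _ t ht => (hIoo t ht).elim)
    (fun _ => integrableOn_empty) (fun x _ t ht => (hIoo t ht).elim)
    (fun x _ => by simp)
  have hempty : KZ.of (KZ.IntegralRep.empty (n + 1)) ∈ R := hrel KZ.IntegralRep.of_empty_mem_relations
  simpa using R.sub_mem hempty key

/-- Hence `R = ⊤`. [folklore] -/
theorem eq_top_of_closedUnderLogNLWithoutLe {R : AddSubgroup KZ.FormalRep} (hrel : KZ.relations ≤ R)
    (hR : ClosedUnderLogNLWithoutLe R) : R = ⊤ := by
  have hall : ∀ c : KZ.FormalRep, c ∈ R := fun c => by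
    induction c using FreeAbelianGroup.induction_on with
    | zero => exact R.zero_mem
    | of p => exact of_mem_of_closedUnderLogNLWithoutLe hrel hR p.2
    | neg p hp => exact R.neg_mem hp
    | add x y hx hy => exact R.add_mem hx hy
  exact eq_top_iff.2 fun c _ => hall c

/-- **Without `a ≤ b` the crux is TRIVIALLY TRUE** (the crux with `a ≤ b` deleted from the rule —
MORE instances, a STRONGER closure hypothesis — holds, even without the guard `eval c = 0`): the
side condition is a vacuity guard, exactly as for `KZ.newtonLeibnizRel` (KZCalculus design note: "the
hypothesis `a ≤ b` on the base is mandatory"). [folklore] -/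
theorem logKernelConjectureWithoutLe_holds :
    ∀ (R : AddSubgroup KZ.FormalRep), KZ.relations ≤ R → ClosedUnderLogNLWithoutLe R →
      ∀ c : KZ.FormalRep, KZ.eval c = 0 → c ∈ R := by
  intro R hrel hR c _
  rw [eq_top_of_closedUnderLogNLWithoutLe hrel hR]
  exact AddSubgroup.mem_top c

end Summit.KontsevichZagierPeriods.LiouvilleUnfolding.LogKernelConjectureNegative
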